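import Literature.MathematicalPhysics.QuantumLattice.BdGBondHamiltonianParticleHole
import Mathlib.Analysis.SpecialFunctions.Log.Deriv
import Mathlib.Analysis.SpecificLimits.Basic
import HarnessLib

/-!
# Log-determinant moment series, light cones and torus balls for BdG Nambu matrices

Topic `Literature/MathematicalPhysics/QuantumLattice` (family `hubbard`), in the story of
`BdGBondHamiltonian(ParticleHole).lean`: the elementary finite-dimensional toolkit by which the
Matsubara log-determinant `log ‖det(𝓗 + it)‖` of a one-body (Nambu) matrix with FINITE-RANGE
bond data is controlled at large `t` by LOCAL data — the standard "moment / light-cone" locality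
argument for lattice operators (purely combinatorial), as used for vison / flux-string
perturbations of lattice BdG Hamiltonians (Senthil–Fisher 2000, §III).  Fully proved, no
definition is introduced:

* Hermitian `A` over `ℂ`: `tr A^m = Σᵢ λᵢ^m` (`hermitian_trace_pow_eq_sum_eigenvalues_pow`),
  `det(A + it) = Πᵢ (λᵢ + it)`, `log ‖det(A + it)‖ = ½ Σᵢ log(λᵢ² + t²)`
  (`hermitian_det_add_I_smul_one_eq_prod`, `hermitian_log_norm_det_add_I_smul_one`) and the
  **log-determinant series**
  `2 log‖det(A+it)‖ − |n| log t² = Σ_k (−1)^k tr A^{2k+2}/((k+1)t^{2k+2})` for `λᵢ² < t²`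
  (`hermitian_hasSum_logDet_series`, from `log(1+u) = Σ_k (−1)^k u^{k+1}/(k+1)`, Mathlib's
  `Real.hasSum_pow_div_log_of_abs_lt_one`);
* `ℓ¹` row-sum bounds propagate to powers (`matrix_sum_norm_pow_apply_le`,
  `matrix_norm_pow_apply_le`) and bound the spectrum
  (`hermitian_eigenvalues_sq_le_of_norm_pow_apply_le`: `|(A^m)_{aa}| ≤ K^m ∀ m ⇒ λᵢ² ≤ K²`);
* the **light cone** of a range-one matrix for any "distance" with the triangle inequality
  (`matrix_pow_apply_eq_of_lightCone`) and invariance of the diagonal of powers under conjugation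
  by a diagonal involution (`diagonal_involution_conj_pow_apply_self`);
* circular geometry of `ℤ/Lℤ` via `|z|_L = |ZMod.valMinAbs z|`: `zmod_val_sub_cases`,
  `zmod_natAbs_valMinAbs_add_le`, balls (`zmod_card_filter_circDist_le`: `≤ 2m+1` points), the
  column-window lemma `zmod_val_lt_iff_of_far_window`, the count
  `fermionTorus_card_nearStringEnd_le` of sites of the fermionic torus `(ℤ/Lℤ)²` near the ends of
  a row-`0` string `[0,R)`, and the sup-circular distance on sites, passed around as a function
  `d` with its defining equation `hd` (`torusSupDist_self`, `torusSupDist_triangle`,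
  `torusSupDist_le_one_of_step`);
* the Nambu matrix `bdgNambuMatrix τ Δ μ`: **gauge covariance of its entries** under `±1` site
  gauges (`bdgNambuMatrix_gauge_orb_orb`) and **row sums** in terms of the bond data
  (`sum_norm_bdgNambuMatrix_orb_le`).

## Mathlib / tree search

REUSED (Mathlib): `Matrix.IsHermitian.spectral_theorem`, `Matrix.IsHermitian.charpoly_eq`,
`Matrix.eval_charpoly`, `Real.hasSum_pow_div_log_of_abs_lt_one`, `hasSum_sum`,
`pow_unbounded_of_one_lt`, `ZMod.valMinAbs_natAbs_eq_min`, `ZMod.natAbs_valMinAbs_add_le`,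
`Finset.card_le_card_of_injOn`.  REUSED (tree): `bdgNambuMatrix_orb_orb`, `sum_orb_eq_sum_sum`
(`BdGBondHamiltonianParticleHole`, `FreeFermionSpinTwistedTraceFormula`), `FermionTorus`
(`HubbardModel`).  `lean search 'hasSum.*log.*det|trace_pow_eq_sum_eigenvalues'`: only
`Literature.Computability.AlgebraicComplexity.trace_pow_eq_sum_eigenvalues_pow` (other namespace,
heavier imports) — restated here in eleven lines.

## References

* T. Senthil, M. P. A. Fisher, *Z₂ gauge theory of electron fractionalization in strongly
  correlated systems*, Phys. Rev. B 62 (2000) 7850, §III (visons as Z₂ fluxes for BdG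
  quasiparticles; local gauge classes). [SenthilFisher2000]
* P. G. de Gennes, *Superconductivity of Metals and Alloys* (1966), Ch. 5 (BdG matrix, gauge
  covariance). [deGennes1966]
-/

noncomputable section

namespace Literature.MathematicalPhysics.QuantumLattice

open scoped Matrix

section Abstract

variable {n : Type*} [Fintype n] [DecidableEq n]

/-- `tr A^m = Σᵢ λᵢ^m` for a Hermitian matrix. [folklore] -/
theorem hermitian_trace_pow_eq_sum_eigenvalues_pow {A : Matrix n n ℂ} (hA : A.IsHermitian)
    (m : ℕ) :    (A ^ m).trace = ∑ i, ((hA.eigenvalues i : ℂ)) ^ m := by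
  have h : A ^ m = Unitary.conjStarAlgAut ℂ _ hA.eigenvectorUnitary
      (Matrix.diagonal fun i => ((hA.eigenvalues i : ℂ)) ^ m) := by
    conv_lhs => rw [hA.spectral_theorem]
    rw [← map_pow, Matrix.diagonal_pow]
    rfl
  rw [h, Unitary.conjStarAlgAut_apply, Matrix.trace_mul_cycle, Unitary.coe_star_mul_self,
    Matrix.one_mul, Matrix.trace_diagonal]

/-- `det(A + it) = Πᵢ (λᵢ + it)` for a Hermitian matrix. [folklore] -/
theorem hermitian_det_add_I_smul_one_eq_prod {A : Matrix n n ℂ} (hA : A.IsHermitian) (t : ℝ) :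
    (A + ((t : ℂ) * Complex.I) • (1 : Matrix n n ℂ)).det =
      ∏ i, ((hA.eigenvalues i : ℂ) + (t : ℂ) * Complex.I) := by
  have h1 : A + ((t : ℂ) * Complex.I) • (1 : Matrix n n ℂ) =
      -(Matrix.scalar n (-((t : ℂ) * Complex.I)) - A) := by
    rw [Matrix.scalar_apply, neg_sub, sub_eq_add_neg, ← Matrix.diagonal_neg,
      Matrix.smul_eq_diagonal_mul]
    simp
  rw [h1, Matrix.det_neg, ← Matrix.eval_charpoly, hA.charpoly_eq, Polynomial.eval_prod,
    ← Finset.card_univ, ← Finset.prod_const, ← Finset.prod_mul_distrib]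
  refine Finset.prod_congr rfl fun i _ => ?_
  rw [Polynomial.eval_sub, Polynomial.eval_X, Polynomial.eval_C]
  change (-1) * (-((t : ℂ) * Complex.I) - (hA.eigenvalues i : ℂ)) = _
  ring

/-- `log ‖det(A + it)‖ = ½ Σᵢ log(λᵢ² + t²)` for Hermitian `A`, `t ≠ 0`. [folklore] -/
theorem hermitian_log_norm_det_add_I_smul_one {A : Matrix n n ℂ} (hA : A.IsHermitian) {t : ℝ}
    (ht : t ≠ 0) :    Real.log ‖(A + ((t : ℂ) * Complex.I) • (1 : Matrix n n ℂ)).det‖ =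
      ∑ i, Real.log (hA.eigenvalues i ^ 2 + t ^ 2) / 2 := by
  have hnorm : ∀ i, ‖(hA.eigenvalues i : ℂ) + (t : ℂ) * Complex.I‖ =
      Real.sqrt (hA.eigenvalues i ^ 2 + t ^ 2) := fun i => by
    rw [Complex.norm_add_mul_I]
  rw [hermitian_det_add_I_smul_one_eq_prod hA, norm_prod, Real.log_prod fun i _ => ?_]
  · refine Finset.sum_congr rfl fun i _ => ?_
    rw [hnorm, Real.log_sqrt (by positivity)]
  · rw [hnorm]
    exact (Real.sqrt_pos.mpr (by positivity)).ne'

/-- For `0 ≤ u < 1`: `log(1+u) = Σ_k (−1)^k u^{k+1}/(k+1)`. [folklore] -/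
theorem hasSum_log_one_add_alternating {u : ℝ} (hu0 : 0 ≤ u) (hu1 : u < 1) :
    HasSum (fun k : ℕ => (-1) ^ k * u ^ (k + 1) / (k + 1)) (Real.log (1 + u)) := by
  have h := (Real.hasSum_pow_div_log_of_abs_lt_one (x := -u)
    (by rwa [abs_neg, abs_of_nonneg hu0])).neg
  rw [sub_neg_eq_add, neg_neg] at h
  have hf : (fun k : ℕ => (-1 : ℝ) ^ k * u ^ (k + 1) / (k + 1)) =
      fun k : ℕ => -((-u) ^ (k + 1) / (k + 1)) := by
    funext k; rw [neg_pow u, pow_succ (-1 : ℝ)]; ring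
  exact hf ▸ h

/-- The log-determinant series `2 log‖det(A+it)‖ − |n| log t² =
Σ_k (−1)^k tr A^{2k+2}/((k+1)t^{2k+2})` for Hermitian `A` with all `λᵢ² < t²`. [folklore] -/
theorem hermitian_hasSum_logDet_series {A : Matrix n n ℂ} (hA : A.IsHermitian) {t : ℝ}
    (ht : 0 < t) (hlt : ∀ i, hA.eigenvalues i ^ 2 < t ^ 2) :
    HasSum (fun k : ℕ => (-1) ^ k * (A ^ (2 * (k + 1))).trace.re / ((k + 1) * t ^ (2 * (k + 1))))
      (2 * Real.log ‖(A + ((t : ℂ) * Complex.I) • (1 : Matrix n n ℂ)).det‖ -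
        Fintype.card n * Real.log (t ^ 2)) := by
  have ht2 : 0 < t ^ 2 := by positivity
  have h1 : ∀ i, HasSum (fun k : ℕ =>
      (-1) ^ k * hA.eigenvalues i ^ (2 * (k + 1)) / ((k + 1) * t ^ (2 * (k + 1))))
      (Real.log (hA.eigenvalues i ^ 2 + t ^ 2) - Real.log (t ^ 2)) := by
    intro i
    have h := hasSum_log_one_add_alternating (u := hA.eigenvalues i ^ 2 / t ^ 2) (by positivity)
      ((div_lt_one ht2).mpr (hlt i))
    have hlog : Real.log (1 + hA.eigenvalues i ^ 2 / t ^ 2) =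
        Real.log (hA.eigenvalues i ^ 2 + t ^ 2) - Real.log (t ^ 2) := by
      rw [← Real.log_div (by positivity) ht2.ne', add_div, div_self ht2.ne', add_comm]
    rw [hlog] at h
    convert h using 1
    funext k
    rw [div_pow, ← pow_mul, ← pow_mul]
    field_simp
  have h2 := hasSum_sum fun i (_ : i ∈ Finset.univ) => h1 i
  convert h2 using 1
  · funext k
    rw [hermitian_trace_pow_eq_sum_eigenvalues_pow hA, Complex.re_sum]
    simp only [← Complex.ofReal_pow, Complex.ofReal_re]
    rw [Finset.mul_sum, Finset.sum_div]
  · rw [hermitian_log_norm_det_add_I_smul_one hA ht.ne', Finset.sum_sub_distrib, Finset.sum_const,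
      Finset.card_univ, nsmul_eq_mul, Finset.mul_sum]
    exact congrArg₂ _ (Finset.sum_congr rfl fun i _ => by ring) rfl

/-- Row sums of powers: if every row of `A` has `ℓ¹`-norm `≤ K` then so does `A^j` with `K^j`.
[folklore] -/
theorem matrix_sum_norm_pow_apply_le {A : Matrix n n ℂ} {K : ℝ}
    (hK : ∀ a, ∑ b, ‖A a b‖ ≤ K) (j : ℕ) : ∀ a, ∑ b, ‖(A ^ j) a b‖ ≤ K ^ j := by
  induction j with
  | zero =>
    intro a
    rw [pow_zero, pow_zero]
    refine (Finset.sum_eq_single a (fun b _ hb => ?_)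
      (fun h => absurd (Finset.mem_univ a) h)).le.trans (by rw [Matrix.one_apply_eq, norm_one])
    rw [Matrix.one_apply_ne' hb, norm_zero]
  | succ j ih =>
    intro a
    have hK0 : 0 ≤ K := (Finset.sum_nonneg fun b _ => norm_nonneg (A a b)).trans (hK a)
    calc ∑ b, ‖(A ^ (j + 1)) a b‖ = ∑ b, ‖∑ c, A a c * (A ^ j) c b‖ := by
          simp only [pow_succ', Matrix.mul_apply]
      _ ≤ ∑ b, ∑ c, ‖A a c‖ * ‖(A ^ j) c b‖ :=
          Finset.sum_le_sum fun b _ => (norm_sum_le _ _).trans (le_of_eq (by simp only [norm_mul]))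
      _ = ∑ c, ‖A a c‖ * ∑ b, ‖(A ^ j) c b‖ := by
          rw [Finset.sum_comm]
          simp only [Finset.mul_sum]
      _ ≤ ∑ c, ‖A a c‖ * K ^ j :=
          Finset.sum_le_sum fun c _ => mul_le_mul_of_nonneg_left (ih c) (norm_nonneg _)
      _ ≤ K * K ^ j := by
          rw [← Finset.sum_mul]
          exact mul_le_mul_of_nonneg_right (hK a) (pow_nonneg hK0 j)
      _ = K ^ (j + 1) := (pow_succ' K j).symm

/-- Entries of powers: `|(A^j)_{ab}| ≤ K^j` under the row-sum bound. [folklore] -/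
theorem matrix_norm_pow_apply_le {A : Matrix n n ℂ} {K : ℝ}
    (hK : ∀ a, ∑ b, ‖A a b‖ ≤ K) (j : ℕ) (a b : n) : ‖(A ^ j) a b‖ ≤ K ^ j :=
  (Finset.single_le_sum (fun b' _ => norm_nonneg ((A ^ j) a b')) (Finset.mem_univ b)).trans
    (matrix_sum_norm_pow_apply_le hK j a)

/-- Diagonal moment bounds `|(A^m)_{aa}| ≤ K^m` (all `m`) force `λᵢ² ≤ K²` (else
`(λᵢ²/K²)^k ≤ |n|` fails for large `k`). [folklore] -/
theorem hermitian_eigenvalues_sq_le_of_norm_pow_apply_le {A : Matrix n n ℂ} (hA : A.IsHermitian)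
    {K : ℝ} (hK : 0 < K)
    (hdiag : ∀ (m : ℕ) (a : n), ‖(A ^ m) a a‖ ≤ K ^ m) (i : n) :
    hA.eigenvalues i ^ 2 ≤ K ^ 2 := by
  refine le_of_not_gt fun hcon => ?_
  have hq : 1 < hA.eigenvalues i ^ 2 / K ^ 2 := (one_lt_div (by positivity)).mpr hcon
  obtain ⟨k, hk⟩ := pow_unbounded_of_one_lt (Fintype.card n : ℝ) hq
  have hsum : hA.eigenvalues i ^ (2 * k) ≤ ∑ j, hA.eigenvalues j ^ (2 * k) :=
    Finset.single_le_sum (f := fun j => hA.eigenvalues j ^ (2 * k))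
      (fun j _ => (even_two_mul k).pow_nonneg _) (Finset.mem_univ i)
  have htr : ∑ j, hA.eigenvalues j ^ (2 * k) = (A ^ (2 * k)).trace.re := by
    rw [hermitian_trace_pow_eq_sum_eigenvalues_pow hA, Complex.re_sum]
    simp only [← Complex.ofReal_pow, Complex.ofReal_re]
  have htr_le : (A ^ (2 * k)).trace.re ≤ Fintype.card n * K ^ (2 * k) := by
    rw [Matrix.trace, Complex.re_sum]
    refine (Finset.sum_le_sum fun a _ => (Complex.re_le_norm _).trans (hdiag _ a)).trans ?_
    rw [Finset.sum_const, Finset.card_univ, nsmul_eq_mul]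
  have hle : (hA.eigenvalues i ^ 2 / K ^ 2) ^ k ≤ Fintype.card n := by
    rw [div_pow, ← pow_mul, ← pow_mul, div_le_iff₀ (by positivity)]
    linarith
  linarith

/-- **Light cone**: if `M` has range `≤ 1` for a "distance" `d` satisfying the triangle inequality
and `M`, `N` agree on all rows at `d`-distance `< r` from `x`, then `(M^j)_{ab} = (N^j)_{ab}`
whenever `d(x,a) + j ≤ r`. [folklore] -/
theorem matrix_pow_apply_eq_of_lightCone {ι : Type*} [Fintype ι] [DecidableEq ι]
    (d : ι → ι → ℕ) (htri : ∀ a b c, d a c ≤ d a b + d b c) {M N : Matrix ι ι ℂ}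
    (hM : ∀ a b, M a b ≠ 0 → d a b ≤ 1) (x : ι) (r : ℕ)
    (hagree : ∀ a b, d x a < r → M a b = N a b) :
    ∀ (j : ℕ) (a b : ι), d x a + j ≤ r → (M ^ j) a b = (N ^ j) a b := by
  intro j
  induction j with
  | zero => intros; simp
  | succ j ih =>
    intro a b hj
    rw [pow_succ', pow_succ', Matrix.mul_apply, Matrix.mul_apply]
    refine Finset.sum_congr rfl fun c _ => ?_
    have hxa : d x a < r := by omega
    by_cases hMac : M a c = 0
    · rw [← hagree a c hxa, hMac, zero_mul, zero_mul]
    · rw [← hagree a c hxa, ih c b ?_]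
      have h1 := hM a c hMac
      have h2 := htri x a c
      omega

/-- Conjugating by a diagonal involution does not change the diagonal of any power. [folklore] -/
theorem diagonal_involution_conj_pow_apply_self {ι : Type*} [Fintype ι] [DecidableEq ι]
    (e : ι → ℂ) (he : ∀ i, e i * e i = 1) (A : Matrix ι ι ℂ) (m : ℕ) (a : ι) :
    ((Matrix.diagonal e * A * Matrix.diagonal e) ^ m) a a = (A ^ m) a a := by
  have hE : Matrix.diagonal e * Matrix.diagonal e = 1 := by
    rw [Matrix.diagonal_mul_diagonal, ← Matrix.diagonal_one]
    exact congrArg Matrix.diagonal (funext he)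
  have hpow : (Matrix.diagonal e * A * Matrix.diagonal e) ^ m =
      Matrix.diagonal e * A ^ m * Matrix.diagonal e := by
    induction m with
    | zero => rw [pow_zero, pow_zero, Matrix.mul_one, hE]
    | succ m ih =>
      rw [pow_succ, ih, pow_succ]
      simp only [Matrix.mul_assoc]
      rw [← Matrix.mul_assoc (Matrix.diagonal e) (Matrix.diagonal e), hE, Matrix.one_mul]
  rw [hpow, Matrix.mul_diagonal, Matrix.diagonal_mul, mul_comm (e a), mul_assoc, he, mul_one]

end Abstract

section Torus

variable {L : ℕ} [NeZero L]

/-- `(a - b).val` in the two cases `b.val ≤ a.val` / `a.val < b.val`. [folklore] -/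
theorem zmod_val_sub_cases (a b : ZMod L) :
    ((a - b).val = a.val - b.val ∧ b.val ≤ a.val) ∨
      ((a - b).val = a.val + L - b.val ∧ a.val < b.val) := by
  rcases le_or_gt b.val a.val with h | h
  · exact Or.inl ⟨ZMod.val_sub h, h⟩
  · refine Or.inr ⟨?_, h⟩
    have h1 := ZMod.val_lt (a - b)
    rcases Nat.lt_or_ge ((a - b).val + b.val) L with h2 | h2
    · have := ZMod.val_add_of_lt h2; rw [sub_add_cancel] at this; omega
    · have := ZMod.val_add_val_of_le h2; rw [sub_add_cancel] at this; omega

omit [NeZero L] in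
/-- Subadditivity of the circular size `|·|_L = |valMinAbs ·|` on `ℤ/Lℤ`. [folklore] -/
theorem zmod_natAbs_valMinAbs_add_le (a b : ZMod L) :
    (a + b).valMinAbs.natAbs ≤ a.valMinAbs.natAbs + b.valMinAbs.natAbs :=
  (ZMod.natAbs_valMinAbs_add_le a b).trans (Int.natAbs_add_le _ _)

/-- At most `2m+1` residues lie within circular distance `m` of a given residue. [folklore] -/
theorem zmod_card_filter_circDist_le (m : ℕ) (c : ZMod L) :
    (Finset.univ.filter fun z : ZMod L => (z - c).valMinAbs.natAbs ≤ m).card ≤ 2 * m + 1 := by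
  calc (Finset.univ.filter fun z : ZMod L => (z - c).valMinAbs.natAbs ≤ m).card
      ≤ (Finset.range (m + 1) ∪ Finset.Ico (L - m) L).card := by
        refine Finset.card_le_card_of_injOn (fun z => (z - c).val) (fun z hz => ?_) ?_
        · simp only [Finset.coe_filter, Finset.mem_univ, true_and, Set.mem_setOf_eq,
            ZMod.valMinAbs_natAbs_eq_min] at hz
          have hv := ZMod.val_lt (z - c)
          simp only [Finset.coe_union, Set.mem_union, Finset.mem_coe, Finset.mem_range,
            Finset.mem_Ico]
          omega
        · intro z _ z' _ h
          simpa using ZMod.val_injective L h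
    _ ≤ (m + 1) + m := (Finset.card_union_le _ _).trans (by
        rw [Finset.card_range, Nat.card_Ico]; omega)
    _ = 2 * m + 1 := by ring

/-- **Column window lemma**: if the columns `0` and `R` are at circular distance `> m` from `c`,
every column within distance `m` of `c` lies on the same side of `R` as `c`. [folklore] -/
theorem zmod_val_lt_iff_of_far_window {R m : ℕ} (hRL : R < L) {c z : ZMod L}
    (h0 : m < c.valMinAbs.natAbs) (hR : m < (c - R).valMinAbs.natAbs)
    (hz : (c - z).valMinAbs.natAbs ≤ m) :
    (z.val < R ↔ c.val < R) := by
  rw [ZMod.valMinAbs_natAbs_eq_min] at h0 hR hz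
  have hc := ZMod.val_lt c
  have hzv := ZMod.val_lt z
  have hRv : ((R : ℕ) : ZMod L).val = R := ZMod.val_natCast_of_lt hRL
  have hsub1 := zmod_val_sub_cases c z
  have hsub2 := zmod_val_sub_cases c (R : ZMod L)
  rw [hRv] at hsub2
  omega

/-- The sites near a string end (row within `m` of row `0`, column within `m` of column `0` or `R`)
number at most `2(2m+1)²`. [folklore] -/
theorem fermionTorus_card_nearStringEnd_le (R m : ℕ) :
    (Finset.univ.filter fun x : FermionTorus 2 L =>
        (x.toTorusSite 1).valMinAbs.natAbs ≤ m ∧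
          ((x.toTorusSite 0).valMinAbs.natAbs ≤ m ∨
            (x.toTorusSite 0 - R).valMinAbs.natAbs ≤ m)).card ≤
      (2 * m + 1) * (2 * (2 * m + 1)) := by
  refine le_trans ?_ ((Finset.card_product _ _).le.trans (Nat.mul_le_mul
    (zmod_card_filter_circDist_le (L := L) m 0) ((Finset.card_union_le _ _).trans
      (Nat.add_le_add (zmod_card_filter_circDist_le (L := L) m 0)
        (zmod_card_filter_circDist_le (L := L) m R) |>.trans (two_mul _).ge))))
  refine Finset.card_le_card_of_injOn (fun x => (x.toTorusSite 1, x.toTorusSite 0))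
    (fun x hx => ?_) ?_
  · simp only [Finset.coe_filter, Finset.mem_univ, true_and, Set.mem_setOf_eq] at hx
    simp only [Finset.coe_product, Set.mem_prod, Finset.mem_coe, Finset.mem_filter,
      Finset.mem_univ, true_and, sub_zero, Finset.mem_union]
    exact hx
  · intro x _ y _ hxy
    simp only [Prod.mk.injEq] at hxy
    apply FermionTorus.equivTorusSite.injective
    funext i
    fin_cases i
    · exact hxy.2
    · exact hxy.1

/-! ### The sup-circular distance on sites (passed as `d` with its defining equation `hd`) -/

variable {d : FermionTorus 2 L → FermionTorus 2 L → ℕ}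
  (hd : ∀ u v : FermionTorus 2 L, d u v =
      max (u.toTorusSite 0 - v.toTorusSite 0).valMinAbs.natAbs
        (u.toTorusSite 1 - v.toTorusSite 1).valMinAbs.natAbs)

include hd in
omit [NeZero L] in
/-- `d u u = 0`. [folklore] -/
theorem torusSupDist_self (u : FermionTorus 2 L) :
    d u u = 0 := by
  rw [hd]; simp [ZMod.valMinAbs_zero]

include hd in
omit [NeZero L] in
/-- Triangle inequality for `d`. [folklore] -/
theorem torusSupDist_triangle (u v w : FermionTorus 2 L) :
    d u w ≤ d u v + d v w := by
  rw [hd, hd, hd]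
  have h0 := zmod_natAbs_valMinAbs_add_le (u.toTorusSite 0 - v.toTorusSite 0)
    (v.toTorusSite 0 - w.toTorusSite 0)
  have h1 := zmod_natAbs_valMinAbs_add_le (u.toTorusSite 1 - v.toTorusSite 1)
    (v.toTorusSite 1 - w.toTorusSite 1)
  rw [sub_add_sub_cancel] at h0 h1
  omega

include hd in
/-- Nearest neighbours are at `d`-distance `≤ 1` (both ways). [folklore] -/
theorem torusSupDist_le_one_of_step {u v : FermionTorus 2 L} {i : Fin 2}
    (h : v.toTorusSite = u.toTorusSite + Pi.single i 1) : d u v ≤ 1 ∧ d v u ≤ 1 := by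
  rw [hd, hd, h, Pi.add_apply, Pi.add_apply, sub_add_cancel_left, sub_add_cancel_left,
    ZMod.natAbs_valMinAbs_neg, ZMod.natAbs_valMinAbs_neg, add_sub_cancel_left, add_sub_cancel_left]
  have h1 : (1 : ZMod L).valMinAbs.natAbs ≤ 1 := by
    rw [ZMod.valMinAbs_natAbs_eq_min, ZMod.val_one_eq_one_mod]
    exact (min_le_left _ _).trans (Nat.mod_le 1 L)
  fin_cases i <;> simp [ZMod.valMinAbs_zero, h1]

end Torus

section Nambu

/-- **Gauge covariance of the Nambu entries**: flipping the bond data by `ε_u ε_v` (`ε = ±1`)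
multiplies the entry `((u,σ),(v,σ'))` by `ε_u ε_v`. [cite: deGennes1966, §5-1 eq. (5-18)] -/
theorem bdgNambuMatrix_gauge_orb_orb {Λ : Type*} [LinearOrder Λ] [Fintype Λ]
    (τ Δ τ' Δ' : Λ → Λ → ℂ) (μ : ℝ) (ε : Λ → ℝ) (u v : Λ)
    (hε : u = v → ε u * ε v = 1) (h1 : τ' u v = ε u * ε v * τ u v)
    (h2 : τ' v u = ε u * ε v * τ v u) (h3 : Δ' u v = ε u * ε v * Δ u v)
    (h4 : Δ' v u = ε u * ε v * Δ v u) (σ σ' : Fin 2) :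
    bdgNambuMatrix τ' Δ' μ (orb u σ) (orb v σ') =
      (ε u : ℂ) * ε v * bdgNambuMatrix τ Δ μ (orb u σ) (orb v σ') := by
  rcases eq_or_ne u v with huv | huv
  · have hc : (ε u : ℂ) * ε v = 1 := by exact_mod_cast hε huv
    rw [hc, one_mul] at h1 h2 h3 h4 ⊢
    rw [bdgNambuMatrix_orb_orb, bdgNambuMatrix_orb_orb, h1, h2, h3, h4]
  · rw [bdgNambuMatrix_orb_orb, bdgNambuMatrix_orb_orb, h1, h2, h3, h4, if_neg huv]
    split_ifs <;> simp [Complex.conj_ofReal] <;> ring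

/-- **Row sums of the Nambu matrix** in terms of the bond data:
`Σ_{o'} ‖𝓗((u,σ), o')‖ ≤ |μ| + Σ_v (‖τ(u,v)‖ + ‖τ(v,u)‖ + ‖Δ(u,v)‖ + ‖Δ(v,u)‖)`.
[folklore] -/
theorem sum_norm_bdgNambuMatrix_orb_le {Λ : Type*} [LinearOrder Λ] [Fintype Λ]
    (τ Δ : Λ → Λ → ℂ) (μ : ℝ) (u : Λ) (σ : Fin 2) :
    ∑ o', ‖bdgNambuMatrix τ Δ μ (orb u σ) o'‖ ≤
      |μ| + ∑ v, (‖τ u v‖ + ‖τ v u‖ + ‖Δ u v‖ + ‖Δ v u‖) := by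
  rw [sum_orb_eq_sum_sum]
  have hrow : ∀ v, ∑ σ', ‖bdgNambuMatrix τ Δ μ (orb u σ) (orb v σ')‖ ≤
      (‖τ u v‖ + ‖τ v u‖ + ‖Δ u v‖ + ‖Δ v u‖) + (if u = v then |μ| else 0) :=
    fun v => by
    have e1 := norm_nonneg (τ u v); have e2 := norm_nonneg (τ v u)
    have e3 := norm_nonneg (Δ u v); have e4 := norm_nonneg (Δ v u)
    have e5 := norm_add_le (Δ u v) (Δ v u)
    have e6 := norm_sub_le (τ u v) (μ : ℂ)
    have e7 := norm_add_le (-τ v u) (μ : ℂ)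
    simp only [Complex.norm_real, Real.norm_eq_abs, norm_neg] at e6 e7
    rw [Fin.sum_univ_two, bdgNambuMatrix_orb_orb, bdgNambuMatrix_orb_orb]
    fin_cases σ
    · simp only [Fin.zero_eta, Fin.isValue, if_true, one_ne_zero, if_false, norm_neg, norm_star]
      split_ifs <;> [skip; rw [sub_zero]] <;> linarith
    · simp only [Fin.mk_one, Fin.isValue, one_ne_zero, if_false, if_true, norm_neg]
      split_ifs <;> [skip; rw [add_zero, norm_neg]] <;> linarith
  refine (Finset.sum_le_sum fun v _ => hrow v).trans (le_of_eq ?_)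
  rw [Finset.sum_add_distrib, Finset.sum_ite_eq, if_pos (Finset.mem_univ _), add_comm]

end Nambu

end Literature.MathematicalPhysics.QuantumLattice

end
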